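import Literature.Geometry.Riemannian.GreatSphereFibrationsHahl
import HarnessLib

/-!
# Hähl 1987, §4.8: the base of a smooth great-3-sphere fibration of `S⁷` is `S⁴` — corrected transcription

Topic `Literature/Geometry/Riemannian`. Source: H. Hähl, *Differentiable fibrations of the
(2n-1)-sphere by great (n-1)-spheres and their coordinatization over quasifields*, Results in
Mathematics 12 (1987) 99–118, doi:10.1007/bf03322382 — Thm. 1.3 (p. 101), Prop. 4.7 (p. 116),
§4.8 (p. 117): for `n = 4` the base `B(π)` of a locally trivial differentiable fibration of `S⁷` by
great 3-spheres is a twisted 4-sphere (Prop. 4.7), hence — by Cerf's `Γ₄ = 0` — diffeomorphic to `S⁴`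
with its usual differentiable structure (§4.8), and the fibration is differentiably equivalent to the
quaternionic Hopf fibration (Thm. 1.3, via 4.2).

What is reproduced: ONLY the statement of §4.8 as a named fact, in the correctly typed hypothesis
form `Literature.Geometry.Riemannian.IsSmoothGreatSphereFibration p` introduced in
`GreatSphereFibrationsHahl.lean` (module note "Correction, continued", which records that the
earlier transcription `Hahl1987_greatSphereFibration_base_sphere` is vacuous as elaborated and asks
for this corrected fact to be vendored under the present name). No proof is given here; users take
`(h : Hahl1987_greatSphereFibration_base_sphere')`. An independent elementary proof of the same
statement (open great hemisphere ≅ base minus a point; graph-chart expansion at the missing fibre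
shows the complementary piece is a star-shaped 4-ball; Cerf) is written up by the seat
`solo-SmoothPoincare4-blind` (run/shared/lean/ideation/SmoothPoincare4/solo-blind/paper/
great-sphere-fibrations.md); it is not formalised.
-/

noncomputable section

open scoped Manifold ContDiff

namespace Literature.Geometry.Riemannian

/-- NAMED FACT (**Hähl 1987, §4.8 with Prop. 4.7 and Thm. 1.3; corrected transcription**). If
`p : S⁷ → M` is a smooth surjective submersion onto a Hausdorff second-countable smooth 4-manifold
all of whose fibres are great 3-spheres `S⁷ ∩ V`, `dim V = 4` — packaged as
`IsSmoothGreatSphereFibration p`, fibre clause an equality of subsets of `S⁷` — then `M` is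
diffeomorphic to the standard `S⁴`. (Hähl: `B(π)` is the twisted sphere `D⁴ ∪_ι D⁴`, `ι` the
normalised inversion of the infinitesimal division algebra, Prop. 4.7; every twisted 4-sphere is
standard by Cerf.) Users take `(h : Hahl1987_greatSphereFibration_base_sphere')`.
[cite: Hahl1987, §4.8 (p. 117) with Prop. 4.7 (p. 116) and Thm. 1.3 (p. 101)] -/
def Hahl1987_greatSphereFibration_base_sphere' : Prop :=
  ∀ (M : Type) [TopologicalSpace M] [T2Space M] [SecondCountableTopology M]
    [ChartedSpace (EuclideanSpace ℝ (Fin 4)) M] [IsManifold (𝓡 4) ∞ M]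
    (p : Metric.sphere (0 : EuclideanSpace ℝ (Fin 8)) 1 → M),
    IsSmoothGreatSphereFibration p →
      Nonempty (M ≃ₘ⟮𝓡 4, 𝓡 4⟯ Metric.sphere (0 : EuclideanSpace ℝ (Fin 5)) 1)

end Literature.Geometry.Riemannian
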